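/-
Copyright (c) 2026. All rights reserved.
Released under Apache 2.0 license as described in the file LICENSE.
Authors: abc-iut cell — abc-iut-w4-d064 (rulings α12-1 (b) / α13-2 (a) / α17-1; ONE-HOME consumer chain for abc-iut-L3-t6's v4 `FiniteLevelDataCpt`: compact twins of abc-iut-L3-t11's estrangement step / (∗_j), abc-iut-L3-t10's reductions and chart transport, abc-iut-w4-d075's At bridge).
-/
import Literature.AnabelianGeometry.SemiGraphs.TemperedLevelDataCpt
import Literature.AnabelianGeometry.SemiGraphs.TemperedChartTransport
import Literature.AnabelianGeometry.SemiGraphs.TemperedCompactInVerticialOfLevelData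
import Literature.AnabelianGeometry.SemiGraphs.TemperedCompactInVerticialAtBridge
import HarnessLib

/-!
# [SemiAnbd] Thm 3.7 (iii) from COMPACT-form finite-level data — the whole consumer chain of (I4′)_cpt

Mochizuki, *Semi-graphs of anabelioids*, Publ. RIMS **42** (2006), §3, Theorem 3.7 (iii), ms pp. 40–41
(proof p. 41: the compact subgroup `H` acts on the finite `𝔾_j` through a finite quotient; "since `𝒢` is
totally estranged … `H_{𝒢_j}` fixes at least one vertex of `𝒢_{∞,j}`") [cite: MochizukiSemiAnbd2006,
Thm 3.7(iii) pp.40-41].  PROOF-ONLY (0 defs, 0 named facts).  Cell ruling α12-1 (finding F-t6g3-1,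
abc-iut-L3-t6): the identification (I4′) of the frozen v3 structure `FiniteLevelData` quantifies over ALL
`g` with an injective `ιQ`, which is not dischargeable over a non-cofinal Galois tower; the additive v4
structure `FiniteLevelDataCpt` (`TemperedLevelDataCpt.lean`, abc-iut-L3-t6) restricts it to COMPACT
subgroups `C` with `Set.InjOn ιQ C` — print-faithful, since p. 41 only ever moves the compact `H`.  This
file ports the ENTIRE v3 consumer chain to v4, each step verbatim up to the compactness bookkeeping:
* `noFixedBranchPairSystem_of_isTotallyEstranged_cpt` — the estrangement step for ONE subgroup `C` after a
  homomorphism injective on `C` (compact twin of abc-iut-L3-t11's `noFixedBranchPairSystem_of_isTotallyEstranged'`;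
  the last line uses injectivity at `g ∈ C` and `1 ∈ C`);
* `FiniteLevelDataCpt.hstar` — the condition (∗_j) for nontrivial COMPACT `C` (abc-iut-L3-t11's
  `SemiGraph.hstar_of_noFixedBranchPairSystem`, verbatim);
* `FiniteLevelDataCpt.compactInVerticial` — Thm 3.7 (iii) at the chart of the data (abc-iut-L3-t10's
  `VerticialLevelData.compactInVerticial_of_hstar` consumes (∗_j) for compact `C` only — exactly what
  (I4′)_cpt delivers); `FiniteLevelDataCpt.compactInVerticial_of` — the ∀-form reduction;
* `FiniteLevelDataCpt.nonempty_of_nonempty` — chart transport (compact twin of abc-iut-L3-t10's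
  `FiniteLevelData.nonempty_of_nonempty`: `C ↦ ψ(C)`, `ιQ ↦ ιQ ∘ ψ`; the transported structure is built
  inside the proof, no `def`);
* `compactInVerticialAt_of_finiteLevelDataCpt` / `_of_finiteCpt` — the per-graph BRIDGES to
  abc-iut-w4-d075's `CompactInVerticialAt 𝒢` (compact twins of `compactInVerticialAt_of_finiteLevelData` /
  `_of_finite`; v3 producers still feed via `FiniteLevelData.toCpt`).
Consumers: abc-iut-L3-t8's (β)-ASM `finiteLevelDataCpt_temperedPiChart` (compact-form data for the tower
chart of every FINITE `𝒢`) ⇒ `CompactInVerticialAt 𝒢` for finite `𝒢` ⇒ abc-iut-w4-d080's per-pair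
`cor39UpToTwistAt`.  Nothing here asserts Thm 3.7 (iii) for an infinite `𝔾`; nothing bears on
[IUTchIII] Cor. 3.12.
-/

namespace Literature.AnabelianGeometry.SemiGraphs

namespace ProfiniteSemiGraph

open CategoryTheory Topology

universe v u

variable {𝒢 : ProfiniteSemiGraph.{u}}

/-! ### (1) The estrangement step, consumer of (I4′)_cpt at ONE compact subgroup -/

/-- **The estrangement step for (I4′)_cpt** (compact twin of abc-iut-L3-t11's
`noFixedBranchPairSystem_of_isTotallyEstranged'`): if the branch-level Remark 2.2.1 identification holds
for the elements of a subgroup `C` of `π₁^temp(𝒢)` after a homomorphism `ιQ` that is injective ON `C`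
(in print: the profinite completion, injective on the compact `H` being moved), then total estrangement
forbids `C ≠ 1` to fix a compatible finite-level system `(w_i; β_i ≠ β'_i)` of a vertex with two distinct
abutting branches — the hypothesis `hnobp` of `SemiGraph.hstar_of_noFixedBranchPairSystem` for `C`.
[cite: MochizukiSemiAnbd2006, Thm 3.7(iii) p.41] -/
theorem noFixedBranchPairSystem_of_isTotallyEstranged_cpt (h𝒢 : 𝒢.Thm37Hypotheses)
    (c : TemperedPiChart 𝒢) {J : Type v} [Preorder J] (level : J → SemiGraph.{u})
    (levelAct : ∀ j, c.G →* Aut (level j)) (levelTrans : ∀ ⦃i j : J⦄, i ≤ j → (level j ⟶ level i))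
    (C : Subgroup c.G)
    (stabBranchPairC : ∀ (j₀ : J) (w : ∀ i : {i : J // j₀ ≤ i}, (level i.1).Vertex)
      (β β' : ∀ i : {i : J // j₀ ≤ i}, (level i.1).Branch),
      (∀ i, β i ≠ β' i ∧ (level i.1).abuts (β i) = some (w i) ∧ (level i.1).abuts (β' i) = some (w i)) →
      (∀ ⦃i i' : {i : J // j₀ ≤ i}⦄ (h : i.1 ≤ i'.1), (levelTrans h).vertexMap (w i') = w i ∧
        (levelTrans h).branchMap (β i') = β i ∧ (levelTrans h).branchMap (β' i') = β' i) →
      ∃ (Q : Type u) (_ : Group Q) (ιQ : c.G →* Q) (v : 𝒢.graph.Vertex) (b b' : 𝒢.graph.Branch)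
        (hb : 𝒢.graph.abuts b = some v) (hb' : 𝒢.graph.abuts b' = some v) (ψ : 𝒢.Gv v →* Q) (x x' : 𝒢.Gv v),
        Set.InjOn ιQ C ∧ Function.Injective ψ ∧ (b' ≠ b ∨ x⁻¹ * x' ∉ 𝒢.branchSubgroup b v hb) ∧
        ∀ g ∈ C, (∀ i, (levelAct i.1 g).hom.vertexMap (w i) = w i ∧
          (levelAct i.1 g).hom.branchMap (β i) = β i ∧ (levelAct i.1 g).hom.branchMap (β' i) = β' i) →
          ιQ g ∈ ((𝒢.branchSubgroup b v hb).map (MulAut.conj x).toMonoidHom).map ψ ⊓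
            ((𝒢.branchSubgroup b' v hb').map (MulAut.conj x').toMonoidHom).map ψ) :
    ∀ (j₀ : J) (w : ∀ i : {i : J // j₀ ≤ i}, (level i.1).Vertex)
      (β β' : ∀ i : {i : J // j₀ ≤ i}, (level i.1).Branch),
      (∀ i, β i ≠ β' i ∧ (level i.1).abuts (β i) = some (w i) ∧ (level i.1).abuts (β' i) = some (w i)) →
      (∀ ⦃i i' : {i : J // j₀ ≤ i}⦄ (h : i.1 ≤ i'.1), (levelTrans h).vertexMap (w i') = w i ∧
        (levelTrans h).branchMap (β i') = β i ∧ (levelTrans h).branchMap (β' i') = β' i) →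
      (∀ (i : {i : J // j₀ ≤ i}) (γ : C), (levelAct i.1 γ).hom.vertexMap (w i) = w i ∧
        (levelAct i.1 γ).hom.branchMap (β i) = β i ∧ (levelAct i.1 γ).hom.branchMap (β' i) = β' i) →
      C = ⊥ := by
  intro j₀ w β β' hpair hcompat hfix
  obtain ⟨Q, _, ιQ, v, b, b', hb, hb', ψ, x, x', hι, hψ, hne, hstab⟩ :=
    stabBranchPairC j₀ w β β' hpair hcompat
  have hest := (h𝒢.isTotallyEstranged (𝒢.graph.edgeOf b)).2 b rfl v hb b' hb' (x⁻¹ * x') hne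
  have hbot := map_conj_inf_map_conj_eq_bot ψ hψ _ _ x x' hest
  rw [eq_bot_iff]
  intro g hg
  have hmem := hstab g hg fun i => hfix i ⟨g, hg⟩
  rw [hbot, Subgroup.mem_bot] at hmem
  exact hι hg C.one_mem (by rw [hmem, map_one])

namespace FiniteLevelDataCpt

variable {c : TemperedPiChart 𝒢}

/-! ### (2) (∗_j) and Thm 3.7 (iii) at the chart of the data -/

/-- **The condition (∗_j)** for a nontrivial COMPACT subgroup `C` of `π₁^temp(𝒢)` acting through
compact-form finite-level data of a chart (compact twin of `FiniteLevelData.hstar`): total estrangement ⇒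
no fixed compatible branch-pair system for `C` ⇒ (∗_j) (`SemiGraph.hstar_of_noFixedBranchPairSystem`,
abc-iut-L3-t11). [cite: MochizukiSemiAnbd2006, Thm 3.7(iii) p.41] -/
theorem hstar (D : FiniteLevelDataCpt.{v} 𝒢 c) (h𝒢 : 𝒢.Thm37Hypotheses) (C : Subgroup c.G)
    (hCcpt : IsCompact (C : Set c.G)) (hC : C ≠ ⊥) (j : D.J) :
    ∃ (i : D.J) (h : j ≤ i), ∀ e e' : (D.tree i).Edge, (∀ γ : C, (D.act i γ).hom.edgeMap e = e) →
      (∀ γ : C, (D.act i γ).hom.edgeMap e' = e') → (D.trans h).edgeMap e = (D.trans h).edgeMap e' :=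
  SemiGraph.hstar_of_noFixedBranchPairSystem C D.tree D.isTree D.act D.trans D.level D.levelAct D.quot
    D.quot_isImmersion D.act_quot D.levelTrans D.levelTrans_id D.levelTrans_comp D.levelTrans_act
    D.trans_quot
    (noFixedBranchPairSystem_of_isTotallyEstranged_cpt h𝒢 c D.level D.levelAct D.levelTrans C
      (D.stabBranchPairCpt' C hCcpt))
    hC j

/-- **Theorem 3.7 (iii) for the chart `c` from compact-form finite-level data** (compact twin of
abc-iut-L3-t10's `FiniteLevelData.compactInVerticial`): both conjuncts of `CompactInVerticial` at `𝒢`, `c`,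
`C`, modulo Thm. 3.7 (ii) (`VerticialDistinct`) and the existence of verticial subgroups at every vertex —
`VerticialLevelData.compactInVerticial_of_hstar` consumes (∗_j) for COMPACT subgroups only, which is all
(I4′)_cpt provides. [cite: MochizukiSemiAnbd2006, Thm 3.7(iii) pp.40-41] -/
theorem compactInVerticial (D : FiniteLevelDataCpt.{v} 𝒢 c) (hVD : VerticialDistinct.{u})
    (h𝒢 : 𝒢.Thm37Hypotheses)
    (hex : ∀ v : 𝒢.graph.Vertex, (verticialSubgroups c v).Nonempty)
    (C : Subgroup c.G) (hC : IsCompact (C : Set c.G)) :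
    (∃ (v : 𝒢.graph.Vertex) (H : Subgroup c.G), H ∈ verticialSubgroups c v ∧ C ≤ H) ∧
      (C ≠ ⊥ → ∀ (v₁ v₂ : 𝒢.graph.Vertex) (H₁ H₂ : Subgroup c.G), H₁ ∈ verticialSubgroups c v₁ →
        H₂ ∈ verticialSubgroups c v₂ → H₁ ≠ H₂ → C ≤ H₁ → C ≤ H₂ →
          (∀ (v₃ : 𝒢.graph.Vertex) (H₃ : Subgroup c.G), H₃ ∈ verticialSubgroups c v₃ → C ≤ H₃ →
              H₃ = H₁ ∨ H₃ = H₂) ∧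
          ∃ (e : 𝒢.graph.Edge) (L : Subgroup c.G), 𝒢.graph.IsClosedEdge e ∧
            L ∈ edgeLikeSubgroups c e ∧ C ≤ L) :=
  VerticialLevelData.compactInVerticial_of_hstar D.toVerticialLevelData hVD h𝒢 hex
    (fun C' hC'cpt hC' j => D.hstar h𝒢 C' hC'cpt hC' j) C hC

/-! ### (3) Chart transport of compact-form finite-level data (def-free) -/

/-- **Compact-form finite-level data for ONE chart give them for EVERY chart** (ASM-2; compact twin of
abc-iut-L3-t10's `FiniteLevelData.nonempty_of_nonempty`): charts are compatibly isomorphic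
(`TemperedPiChart.exists_compatIso`), the §3 vocabulary transports (`mem_verticialSubgroups_iff_map`,
`mem_edgeLikeSubgroups_iff_map`), and the data transport along the compatible isomorphism
`ψ : c.G → c₀.G` — the tree-level part by `VerticialLevelData.transport`, the finite levels with actions
precomposed with `ψ`, and (I4′)_cpt with `C ↦ ψ(C)` (compact as a continuous image) and `ιQ ↦ ιQ ∘ ψ`
(injective on `C` because `ιQ` is injective on `ψ(C)` and `ψ` is injective).  Def-free on purpose (proof
lane): the transported structure is built inside the proof. [cite: MochizukiSemiAnbd2006, Thm 3.7(iii) p.41] -/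
theorem nonempty_of_nonempty {c₀ : TemperedPiChart 𝒢} (h : Nonempty (FiniteLevelDataCpt.{v} 𝒢 c₀))
    (c : TemperedPiChart 𝒢) : Nonempty (FiniteLevelDataCpt.{v} 𝒢 c) := by
  obtain ⟨D⟩ := h
  obtain ⟨φ, ψ, hψφ, hφψ, hφ, hψ⟩ := TemperedPiChart.exists_compatIso c₀ c
  have hV : ∀ (v : 𝒢.graph.Vertex) (H : Subgroup c.G),
      H ∈ verticialSubgroups c v ↔ H.map ψ.toMonoidHom ∈ verticialSubgroups c₀ v :=
    fun v H => mem_verticialSubgroups_iff_map φ hφ ψ hφψ hψ H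
  have hE : ∀ (e : 𝒢.graph.Edge) (L : Subgroup c.G),
      L ∈ edgeLikeSubgroups c e ↔ L.map ψ.toMonoidHom ∈ edgeLikeSubgroups c₀ e :=
    fun e L => mem_edgeLikeSubgroups_iff_map φ hφ ψ hφψ hψ L
  have hψinj : Function.Injective ψ := fun y₁ y₂ h => by rw [← hφψ y₁, ← hφψ y₂, h]
  refine ⟨{ toVerticialLevelData := D.toVerticialLevelData.transport φ ψ hψφ hφψ hV hE
            level := D.level
            finiteVertex := D.finiteVertex
            finiteBranch := D.finiteBranch
            quot := D.quot
            quot_isImmersion := D.quot_isImmersion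
            levelAct := fun j => (D.levelAct j).comp ψ.toMonoidHom
            act_quot := fun j g => D.act_quot j (ψ g)
            levelTrans := D.levelTrans
            levelTrans_id := D.levelTrans_id
            levelTrans_comp := D.levelTrans_comp
            levelTrans_act := fun _ _ h g => D.levelTrans_act h (ψ g)
            trans_quot := D.trans_quot
            stabBranchPairCpt' := fun C hC j₀ w β β' hpair hcompat => ?_ }⟩
  have hCψ : IsCompact ((C.map ψ.toMonoidHom : Subgroup c₀.G) : Set c₀.G) := by
    rw [Subgroup.coe_map]
    exact hC.image ψ.continuous
  obtain ⟨Q, _, ιQ, v, b, b', hb, hb', ψQ, x, x', hι, hψQ, hne, hst⟩ :=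
    D.stabBranchPairCpt' (C.map ψ.toMonoidHom) hCψ j₀ w β β' hpair hcompat
  refine ⟨Q, inferInstance, ιQ.comp ψ.toMonoidHom, v, b, b', hb, hb', ψQ, x, x', ?_, hψQ, hne,
    fun g hg hfix => hst (ψ g) ⟨g, hg, rfl⟩ hfix⟩
  intro y₁ hy₁ y₂ hy₂ h
  exact hψinj (hι ⟨y₁, hy₁, rfl⟩ ⟨y₂, hy₂, rfl⟩ h)

/-! ### (4) The ∀-form and the per-graph (At) BRIDGES -/

/-- **`CompactInVerticial` (Thm 3.7 (iii) as typed, for every `𝒢`) REDUCED to Thm 3.7 (ii), (i) and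
compact-form finite-level data for every chart** (compact twin of `FiniteLevelData.compactInVerticial_of`).
[cite: MochizukiSemiAnbd2006, Thm 3.7(iii) pp.40-41] -/
theorem compactInVerticial_of (hVD : VerticialDistinct.{u}) (hVI : VerticialInjective.{u})
    (hD : ∀ (𝒢 : ProfiniteSemiGraph.{u}), 𝒢.Thm37Hypotheses → ∀ (c : TemperedPiChart 𝒢),
      Nonempty (FiniteLevelDataCpt.{v} 𝒢 c)) :
    CompactInVerticial.{u} := by
  intro 𝒢 h𝒢 c C hC
  obtain ⟨D⟩ := hD 𝒢 h𝒢 c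
  exact D.compactInVerticial hVD h𝒢 (fun v => (hVI 𝒢 h𝒢 c v).1) C hC

end FiniteLevelDataCpt

/-- **BRIDGE (compact-form producer ⇒ per-graph (iii))**: compact-form finite-level data for SOME chart
`c₀` of `𝒢` give `CompactInVerticialAt 𝒢` — at EVERY chart, by the chart transport
`FiniteLevelDataCpt.nonempty_of_nonempty`, the reduction `FiniteLevelDataCpt.compactInVerticial`, and
Thm 3.7 (i), (ii) (`verticialInjective_holds`, `verticialDistinct_holds`); compact twin of abc-iut-w4-d075's
`compactInVerticialAt_of_finiteLevelData`. [cite: MochizukiSemiAnbd2006, Thm 3.7(iii) pp.40-41] -/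
theorem compactInVerticialAt_of_finiteLevelDataCpt
    (hD : ∃ c₀ : TemperedPiChart 𝒢, Nonempty (FiniteLevelDataCpt.{v} 𝒢 c₀)) : CompactInVerticialAt 𝒢 := by
  intro h𝒢 c C hC
  obtain ⟨c₀, h₀⟩ := hD
  obtain ⟨D⟩ := FiniteLevelDataCpt.nonempty_of_nonempty h₀ c
  exact D.compactInVerticial verticialDistinct_holds h𝒢
    (fun v => (verticialInjective_holds 𝒢 h𝒢 c v).1) C hC

/-- **Thm 3.7 (iii) AT every FINITE `𝒢`** from a compact-form producer statement for finite `𝒢` (the φ2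
finite twin in the (I4′)_cpt currency; compact twin of `compactInVerticialAt_of_finite`).
[cite: MochizukiSemiAnbd2006, Thm 3.7(iii) pp.40-41] -/
theorem compactInVerticialAt_of_finiteCpt
    (hDfin : ∀ (𝒢 : ProfiniteSemiGraph.{u}), 𝒢.Thm37Hypotheses → Finite 𝒢.graph.Vertex →
      Finite 𝒢.graph.Edge → ∃ c₀ : TemperedPiChart 𝒢, Nonempty (FiniteLevelDataCpt.{v} 𝒢 c₀))
    (hV : Finite 𝒢.graph.Vertex) (hE : Finite 𝒢.graph.Edge) : CompactInVerticialAt 𝒢 :=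
  fun h𝒢 => compactInVerticialAt_of_finiteLevelDataCpt (hDfin 𝒢 h𝒢 hV hE) h𝒢

end ProfiniteSemiGraph

end Literature.AnabelianGeometry.SemiGraphs
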